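import Mathlib
import HarnessLib
import Summits.HubbardSuperconductivity.HubbardSuperconductivity.Theorems.KLProgrammeC4aFoldCurvaturePartnerBand

/-!
# Route `KLProgramme` — crux C4a, S3 brick (B4, DIRECT SHEET): the CURVATURE-FLOOR WINDOW for the two-node control — under `FrameOK` the level-`0` pp partner band is
# uniformly convex in the loop angle, `2·(3/400·u_min²) ≤ ∂²_φ ē(0,φ;0,ϑ,θ)`, on the window `|φ|, |ϑ| ≤ W` as soon as `W·L_c ≤ (3/200)·u_min²`

Cell `gate-hubbard-kl`, seat hubbard-kl-k3c3-p3 (g25; row «implicit-function / monotonicity route for μ(n)»).  Located brick «(B4)-DIRECT-COUNT» (memo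
HOME/hubbard-kl-k3c3-p3/B4-DIRECT-COUNT.md §1): discharges the curvature-floor hypothesis `hc` of `…C4aTwoNodeControl.abs_iteratedDeriv_partnerBand_pp_base_le_mul_abs` /
`…C4aBandDistanceControl.abs_iteratedDeriv_partnerBand_pp_base_le_band_distance` from g21's `…C4aFoldCurvaturePartnerBand.iteratedDeriv_two_partnerBand_pp_angle_ge` (the fold
curvature of the partner band against `2b_T(θ) ≥ (3/100)u_min²` under `FrameOK`), specialised to the loop's Fermi level `e = 0` and offset `ρ = 0`: the error `L(|φ|, 0, 0, |ϑ|)` is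
linear in `|φ| + |ϑ|` with the explicit slope

  `L_c := 2·K₃·D₁³ + 4·K₂·D₁·D₂ + K₁·D₃`   (`D_j = msD A₃ A₄ j`),

so on `|φ|, |ϑ| ≤ W` with `W·L_c ≤ (3/200)u_min²` the floor is `2c` with **`c = (3/400)·u_min²`** — a window of `ϑ`-INDEPENDENT size containing both θ-fixed crossings `0, ϑ`
whenever `|ϑ| ≤ W` (`partnerBand_pp_level_zero_curvature_floor_window`; base-angle form `…_base`).  Binder = `…C4aFoldCurvaturePartnerBand` §3
(`hA hA20 hd hr hlo hhi hA₃ hA₄ hK₁ hK₂ hK₃` + `FrameOK`).  Pure bookkeeping; nothing about the model's sizes beyond `FrameOK`; nothing asserts (C), K3 or superconductivity.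
References: FST II CPAM 51 (1998) §3 (curvature of the Fermi curve, Lemma 2.1); BGM 2006 §2.4 [cite: BenfattoGiulianiMastropietro2006].
-/

noncomputable section

namespace Summit.HubbardSuperconductivity.HubbardSuperconductivity.Theorems.C4a

set_option linter.dupNamespace false -- summit = problem name (single-conjunct summit), D-0017

open Real Set Filter
open scoped Topology
open Literature.MathematicalPhysics.QuantumLattice Literature.MathematicalPhysics.QuantumLattice.BandSectorCounting Literature.Probability.LatticeModels
open Summit.HubbardSuperconductivity.HubbardSuperconductivity.Theorems.KLRegimeSplit
open Summit.HubbardSuperconductivity.HubbardSuperconductivity.Theorems.DispersionFlow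
open Summit.HubbardSuperconductivity.HubbardSuperconductivity.Theorems.PerturbedFermiCurve

section Sizes

variable {K : TrigPolyC4v} {A : ℝ} (hA : ∀ p : Momentum, ∀ j ≤ 2, ‖iteratedFDeriv ℝ j (frameShift K) p‖ ≤ A) (hA20 : A ≤ 1 / 20)
  (hd : klCurveD ≤ (bandBounds (show (-4 : ℝ) < -1.1 by norm_num) (show (-1.1 : ℝ) ≤ -0.1 by norm_num)
    (show (-0.1 : ℝ) < 0 by norm_num)).Dtmin - 2 * A)
  {μ r : ℝ} (hr : 0 < r) (hlo : (-1.1 : ℝ) < μ - r - A) (hhi : μ + r + A < -0.1)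
  {A₃ A₄ : ℝ} (hA₃ : ∀ p : Momentum, ‖iteratedFDeriv ℝ 3 (frameShift K) p‖ ≤ A₃)
  (hA₄ : ∀ p : Momentum, ‖iteratedFDeriv ℝ 4 (frameShift K) p‖ ≤ A₄)
  {K₁ K₂ K₃ : ℝ} (hK₁ : ∀ p : Momentum, ‖fderiv ℝ (frameLevel μ K) p‖ ≤ K₁) (hK₂ : ∀ p : Momentum, ‖iteratedFDeriv ℝ 2 (frameLevel μ K) p‖ ≤ K₂)
  (hK₃ : ∀ p : Momentum, ‖iteratedFDeriv ℝ 3 (frameLevel μ K) p‖ ≤ K₃)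
include hA hA20 hd hr hlo hhi hA₃ hA₄ hK₁ hK₂ hK₃

/-- **CURVATURE-FLOOR WINDOW at the loop's Fermi level, `ρ = 0`** (co-moving form, loop angle `φ` about the base point): under `FrameOK`, for `|ϑ| ≤ W`, `|φ| ≤ W` and
`W·(2K₃D₁³ + 4K₂D₁D₂ + K₁D₃) ≤ (3/200)u_min²`: `2·(3/400·u_min²) ≤ ∂²_φ e_K(S_{0ϑθ}(0) − Φ(0, φ+θ))`. -/
theorem partnerBand_pp_level_zero_curvature_floor_window {R : RenConsts} {U : ℝ} {N : ℕ} (hF : FrameOK R U N μ K) {W : ℝ}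
    (hW : W * (2 * K₃ * msD A₃ A₄ 1 ^ 3 + 4 * K₂ * msD A₃ A₄ 1 * msD A₃ A₄ 2 + K₁ * msD A₃ A₄ 3) ≤
      3 / 200 * (bandBounds (show (-4 : ℝ) < -1.1 by norm_num) (show (-1.1 : ℝ) ≤ -0.1 by norm_num) (show (-0.1 : ℝ) < 0 by norm_num)).umin ^ 2)
    {ϑ : ℝ} (hϑ : |ϑ| ≤ W) (θ : ℝ) {φ : ℝ} (hφ : |φ| ≤ W) :
    2 * (3 / 400 * (bandBounds (show (-4 : ℝ) < -1.1 by norm_num) (show (-1.1 : ℝ) ≤ -0.1 by norm_num) (show (-0.1 : ℝ) < 0 by norm_num)).umin ^ 2) ≤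
      iteratedDeriv 2 (fun x : ℝ => frameLevel μ K (pairSumPath μ K 0 ϑ θ 0 - levelPoint μ K 0 (x + θ))) φ := by
  have h0 : |(0 : ℝ)| < r := by simpa using hr
  have hmain := iteratedDeriv_two_partnerBand_pp_angle_ge hA hA20 hd hr hlo hhi hA₃ hA₄ hK₁ hK₂ hK₃ hF h0 h0 ϑ θ φ
  simp only [abs_zero, zero_div, zero_add, mul_zero, add_zero] at hmain
  set B₀ := bandBounds (show (-4 : ℝ) < -1.1 by norm_num) (show (-1.1 : ℝ) ≤ -0.1 by norm_num) (show (-0.1 : ℝ) < 0 by norm_num) with hB₀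
  -- nonnegativity of the table entries and of the band constants
  have hK₁0 : 0 ≤ K₁ := (norm_nonneg _).trans (hK₁ 0)
  have hK₂0 : 0 ≤ K₂ := (norm_nonneg _).trans (hK₂ 0)
  have hK₃0 : 0 ≤ K₃ := (norm_nonneg _).trans (hK₃ 0)
  have hD10 : 0 ≤ msD A₃ A₄ 1 := (norm_nonneg _).trans (norm_iteratedDeriv_levelPoint_le hA hA20 hd hlo hhi hA₃ hA₄ h0 le_rfl (by norm_num) 0)
  have hD20 : 0 ≤ msD A₃ A₄ 2 := (norm_nonneg _).trans (norm_iteratedDeriv_levelPoint_le hA hA20 hd hlo hhi hA₃ hA₄ h0 (i := 2) (by norm_num) (by norm_num) 0)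
  have hD30 : 0 ≤ msD A₃ A₄ 3 := (norm_nonneg _).trans (norm_iteratedDeriv_levelPoint_le hA hA20 hd hlo hhi hA₃ hA₄ h0 (i := 3) (by norm_num) (by norm_num) 0)
  have hW0 : 0 ≤ W := (abs_nonneg ϑ).trans hϑ
  set D₁ := msD A₃ A₄ 1 with hD₁
  set D₂ := msD A₃ A₄ 2 with hD₂
  set D₃ := msD A₃ A₄ 3 with hD₃
  -- the linear error is at most `W·L_c`
  have e1 : K₃ * (D₁ * |ϑ| + D₁ * |φ|) * D₁ ^ 2 ≤ W * (2 * K₃ * D₁ ^ 3) := by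
    have : D₁ * |ϑ| + D₁ * |φ| ≤ D₁ * W + D₁ * W := add_le_add (mul_le_mul_of_nonneg_left hϑ hD10) (mul_le_mul_of_nonneg_left hφ hD10)
    nlinarith [mul_nonneg hK₃0 (sq_nonneg D₁), mul_le_mul_of_nonneg_left this (mul_nonneg hK₃0 (sq_nonneg D₁))]
  have e2 : K₂ * (D₂ * |φ|) * (D₁ + D₁) ≤ W * (2 * K₂ * D₁ * D₂) := by
    have : D₂ * |φ| ≤ D₂ * W := mul_le_mul_of_nonneg_left hφ hD20
    nlinarith [mul_nonneg hK₂0 hD10, mul_le_mul_of_nonneg_left this (mul_nonneg hK₂0 (add_nonneg hD10 hD10))]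
  have e3 : K₂ * (D₁ * |ϑ| + D₁ * |φ|) * D₂ ≤ W * (K₂ * D₁ * D₂) + W * (K₂ * D₁ * D₂) := by
    have : D₁ * |ϑ| + D₁ * |φ| ≤ D₁ * W + D₁ * W := add_le_add (mul_le_mul_of_nonneg_left hϑ hD10) (mul_le_mul_of_nonneg_left hφ hD10)
    nlinarith [mul_nonneg hK₂0 hD20, mul_le_mul_of_nonneg_left this (mul_nonneg hK₂0 hD20)]
  have e4 : K₁ * (D₃ * |φ|) ≤ W * (K₁ * D₃) := by
    have : D₃ * |φ| ≤ D₃ * W := mul_le_mul_of_nonneg_left hφ hD30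
    nlinarith [mul_le_mul_of_nonneg_left this hK₁0]
  have hsum : K₃ * (D₁ * |ϑ| + D₁ * |φ|) * D₁ ^ 2 + K₂ * (D₂ * |φ|) * (D₁ + D₁) + K₂ * (D₁ * |ϑ| + D₁ * |φ|) * D₂ + K₁ * (D₃ * |φ|) ≤
      W * (2 * K₃ * D₁ ^ 3 + 4 * K₂ * D₁ * D₂ + K₁ * D₃) := by nlinarith [e1, e2, e3, e4]
  linarith [hmain, hsum, hW]

/-- **… in base-angle form** (the `hc` hypothesis of `…C4aTwoNodeControl` / `…C4aBandDistanceControl` on the window `[−W, W] ∋ 0, ϑ`): for `|ϑ| ≤ W` and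
`W·L_c ≤ (3/200)u_min²`, every `x ∈ [−W, W]` has `2·(3/400·u_min²) ≤ ∂²_x e_K(Φ(0,θ) + Φ(0,ϑ+θ) − Φ(0, x+θ))`. -/
theorem partnerBand_pp_level_zero_curvature_floor_window_base {R : RenConsts} {U : ℝ} {N : ℕ} (hF : FrameOK R U N μ K) {W : ℝ}
    (hW : W * (2 * K₃ * msD A₃ A₄ 1 ^ 3 + 4 * K₂ * msD A₃ A₄ 1 * msD A₃ A₄ 2 + K₁ * msD A₃ A₄ 3) ≤
      3 / 200 * (bandBounds (show (-4 : ℝ) < -1.1 by norm_num) (show (-1.1 : ℝ) ≤ -0.1 by norm_num) (show (-0.1 : ℝ) < 0 by norm_num)).umin ^ 2)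
    {ϑ : ℝ} (hϑ : |ϑ| ≤ W) (θ : ℝ) :
    ∀ x ∈ Icc (-W) W, 2 * (3 / 400 * (bandBounds (show (-4 : ℝ) < -1.1 by norm_num) (show (-1.1 : ℝ) ≤ -0.1 by norm_num) (show (-0.1 : ℝ) < 0 by norm_num)).umin ^ 2) ≤
      iteratedDeriv 2 (fun φ : ℝ => frameLevel μ K (levelPoint μ K 0 θ + levelPoint μ K 0 (ϑ + θ) - levelPoint μ K 0 (φ + θ))) x := by
  intro x hx
  have hxW : |x| ≤ W := abs_le.2 ⟨hx.1, hx.2⟩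
  have h := partnerBand_pp_level_zero_curvature_floor_window hA hA20 hd hr hlo hhi hA₃ hA₄ hK₁ hK₂ hK₃ hF hW hϑ θ hxW
  have hfun : (fun x : ℝ => frameLevel μ K (pairSumPath μ K 0 ϑ θ 0 - levelPoint μ K 0 (x + θ))) =
      fun φ : ℝ => frameLevel μ K (levelPoint μ K 0 θ + levelPoint μ K 0 (ϑ + θ) - levelPoint μ K 0 (φ + θ)) := by
    funext x; simp only [pairSumPath, add_zero]
  rw [hfun] at h
  exact h

end Sizes

end Summit.HubbardSuperconductivity.HubbardSuperconductivity.Theorems.C4a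

end
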